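import Summits.ValiantsHypothesis.ValiantsHypothesis.Theorems.BarrierLeverAnchoredDoorHitsLowerPairsStarSpec

/-!
# Support item `AnchoredDoorHitsLowerPairs` (stmt-ValiantsHypothesis-22510), line `anchored-peeling`:
# the PRODUCT-RULE TROPICAL ENGINE for the anchored door 𝔄_s

Helper file (`--supports stmt-ValiantsHypothesis-22510`; cell valiant-natproofs, rung V4, 𝒟-side door (c); registered line
`Cruxes/AnchoredDoorHitsLowerPairs/Lines/anchored_peeling.lean` v3; prover seat val-np-p4 gen 16). Closes NO item.

THE DEVICE (val-np-p4 g15 memo `MEMO-tropical-certificates-anchored`, «product rule»; kernel form here). To show that the symbolic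
partition minor `symbolicDet s h r u w ∈ ℂ[θ, φ, ψ]` of the anchored door is a nonzero polynomial it suffices to exhibit ONE ring map
`ℂ[θ, φ, ψ] → ℂ[T]` under which the layout matrix has nonzero determinant. We use the SPARSE TROPICAL SPECIALISATION attached to a
set `K` of anchors: `θ_α ↦ T^{λ(α.1)·λ(α.2)}` for `α ∈ K` and `0` otherwise, every `x`-twist `φ ↦ 0`, every `y`-twist
`ψ_{α d} ↦ T^{λ(α.1)·2^d}`, where `λ(U) = Σ_{a ∈ U} 2^a` (`wt`, injective in `U`). The specialised witness is the image under
`ℕ[T] → ℂ[T]` of the natural-coefficient polynomial `tropW K` (`map_specHom_symbolicWitness`, `map_natCast_tropW`), and: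

* UPPER BOUND (`natDegree_coeff_tropW_le`): every entry `[x^U y^W] tropW K` has `T`-degree `≤ λ(U)·λ(W)`. Proof by a multiplicative
  DEGREE-BOUND PREDICATE «`natDegree ([m] f) ≤ q m` for all monomials `m`» which is closed under products as soon as `q` is
  superadditive (`degLE_mul`, `degLE_prod`; here `q m = Λ(m)·Μ(m)` with the additive monomial weights `xwt`, `ywt`), plus a
  support-aware product rule (`degLE_mul_of_support`) for the anchor factor `θ x^A y^B · ∏_d (1 + ψ_d y_d)` — no anchored-partition
  combinatorics is needed.
* LOWER BOUND (`one_le_coeff_tropW_anchor`, `coeff_tropW_zero`): if `(U | {c}) ∈ K` and `c ∈ W` then the coefficient of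
  `T^{λ(U)λ(W)}` in `[x^U y^W] tropW K` is `≥ 1` (the term «anchor `(U|{c})`, `y`-tails `W ∖ {c}`»), and `[1] tropW K` has constant
  term `≥ 1`; everything lives in `ℕ[T]`, so lower bounds follow from `Finset.single_le_sum` after `Finset.prod_one_add`.
The sequel `…AnchoredDoorHitsLowerPairsThinSide` adds the tropical determinant lemma (diagonal form) and the strict rearrangement
inequality and assembles: for every `s ≥ 1`, EVERY `h`, every pair of injective families with all rows of size `≤ s` (columns
arbitrary) and matched emptiness, `symbolicDet s h r u w ≠ 0`.

Bookkeeping `def`s only: `wt`, `xwt`, `ywt` (weights), `sparseW` (the sparse anchored product over any coefficient semiring),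
`tropSpec` (the specialisation of the parameters), `tropW` (the `ℕ[T]` form).

WHAT THIS IS NOT: no statement about items 22510 / 19717 themselves (see the sequel); nothing on `stub_rigidPairs` (thick × thick pairs);
nothing on crux stmt-ValiantsHypothesis-14610 or on `VP` versus `VNP`.
-/

set_option linter.dupNamespace false

namespace Summit.ValiantsHypothesis.ValiantsHypothesis.Theorems.BarrierLever.AnchoredPeeling

open Finset MvPolynomial
open Summit.ValiantsHypothesis.ValiantsHypothesis.Theorems.BarrierLever.BrickCalculus (pexpo pexpo_def pexpo_le_iff
  pexpo_apply_castAdd pexpo_apply_natAdd)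

noncomputable section

namespace ProductRule

/-! ## 1. The multiplicative degree-bound predicate on `MvPolynomial σ S[T]` -/

section DegBound

variable {σ : Type*} {S : Type*} [CommSemiring S]

/-- `1` satisfies every degree bound. -/
theorem degLE_one (q : (σ →₀ ℕ) → ℕ) : ∀ m, (coeff m (1 : MvPolynomial σ (Polynomial S))).natDegree ≤ q m := by
  classical
  intro m
  rw [MvPolynomial.coeff_one]
  split_ifs
  · rw [Polynomial.natDegree_one]; exact Nat.zero_le _
  · rw [Polynomial.natDegree_zero]; exact Nat.zero_le _

/-- Degree bounds are additive-closed. -/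
theorem degLE_add {q : (σ →₀ ℕ) → ℕ} {f g : MvPolynomial σ (Polynomial S)}
    (hf : ∀ m, (coeff m f).natDegree ≤ q m) (hg : ∀ m, (coeff m g).natDegree ≤ q m) :
    ∀ m, (coeff m (f + g)).natDegree ≤ q m := fun m => by
  rw [coeff_add]
  exact (Polynomial.natDegree_add_le _ _).trans (max_le (hf m) (hg m))

/-- Degree bounds pass to finite sums. -/
theorem degLE_sum {ι : Type*} {q : (σ →₀ ℕ) → ℕ} (s : Finset ι) (f : ι → MvPolynomial σ (Polynomial S))
    (hf : ∀ i ∈ s, ∀ m, (coeff m (f i)).natDegree ≤ q m) :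
    ∀ m, (coeff m (∑ i ∈ s, f i)).natDegree ≤ q m := fun m => by
  rw [coeff_sum]
  exact Polynomial.natDegree_sum_le_of_forall_le _ _ (fun i hi => hf i hi m)

/-- **Support-aware product rule.** If `[m] f` has degree `≤ F m`, `[m] g` has degree `≤ G m`, and `F m₁ + G m₂ ≤ H (m₁ + m₂)`
whenever `m₁ ∈ support f`, `m₂ ∈ support g`, then `[m] (f g)` has degree `≤ H m`. -/
theorem degLE_mul_of_support {F G H : (σ →₀ ℕ) → ℕ} {f g : MvPolynomial σ (Polynomial S)}
    (hf : ∀ m, (coeff m f).natDegree ≤ F m) (hg : ∀ m, (coeff m g).natDegree ≤ G m)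
    (hFG : ∀ m₁ ∈ f.support, ∀ m₂ ∈ g.support, F m₁ + G m₂ ≤ H (m₁ + m₂)) :
    ∀ m, (coeff m (f * g)).natDegree ≤ H m := fun m => by
  classical
  rw [coeff_mul]
  refine Polynomial.natDegree_sum_le_of_forall_le _ _ (fun x hx => ?_)
  rw [Finset.HasAntidiagonal.mem_antidiagonal] at hx
  by_cases h1 : x.1 ∈ f.support
  · by_cases h2 : x.2 ∈ g.support
    · calc (coeff x.1 f * coeff x.2 g).natDegree
          ≤ (coeff x.1 f).natDegree + (coeff x.2 g).natDegree := Polynomial.natDegree_mul_le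
        _ ≤ F x.1 + G x.2 := Nat.add_le_add (hf x.1) (hg x.2)
        _ ≤ H (x.1 + x.2) := hFG x.1 h1 x.2 h2
        _ = H m := by rw [hx]
    · rw [MvPolynomial.notMem_support_iff.mp h2, mul_zero, Polynomial.natDegree_zero]; exact Nat.zero_le _
  · rw [MvPolynomial.notMem_support_iff.mp h1, zero_mul, Polynomial.natDegree_zero]; exact Nat.zero_le _

/-- **Product rule for a superadditive bound.** -/
theorem degLE_mul {q : (σ →₀ ℕ) → ℕ} (hq : ∀ m₁ m₂, q m₁ + q m₂ ≤ q (m₁ + m₂)) {f g : MvPolynomial σ (Polynomial S)}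
    (hf : ∀ m, (coeff m f).natDegree ≤ q m) (hg : ∀ m, (coeff m g).natDegree ≤ q m) :
    ∀ m, (coeff m (f * g)).natDegree ≤ q m :=
  degLE_mul_of_support hf hg (fun m₁ _ m₂ _ => hq m₁ m₂)

/-- Finite products under a superadditive bound. -/
theorem degLE_prod {ι : Type*} {q : (σ →₀ ℕ) → ℕ} (hq : ∀ m₁ m₂, q m₁ + q m₂ ≤ q (m₁ + m₂)) (s : Finset ι)
    (f : ι → MvPolynomial σ (Polynomial S)) (hf : ∀ i ∈ s, ∀ m, (coeff m (f i)).natDegree ≤ q m) :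
    ∀ m, (coeff m (∏ i ∈ s, f i)).natDegree ≤ q m := by
  classical
  induction s using Finset.induction_on with
  | empty => rw [Finset.prod_empty]; exact degLE_one q
  | insert a s ha ih =>
    rw [Finset.prod_insert ha]
    exact degLE_mul hq (hf a (Finset.mem_insert_self a s)) (ih fun i hi => hf i (Finset.mem_insert_of_mem hi))

/-- A single monomial `monomial m₀ p` satisfies the bound as soon as `natDegree p ≤ q m₀`. -/
theorem degLE_monomial {q : (σ →₀ ℕ) → ℕ} (m₀ : σ →₀ ℕ) (p : Polynomial S) (hp : p.natDegree ≤ q m₀) :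
    ∀ m, (coeff m (monomial m₀ p)).natDegree ≤ q m := fun m => by
  classical
  rw [coeff_monomial]
  split_ifs with hm
  · rw [← hm]; exact hp
  · rw [Polynomial.natDegree_zero]; exact Nat.zero_le _

end DegBound

/-! ## 2. Binary weights -/

variable {h : ℕ}

/-- The binary weight `λ(U) = Σ_{a ∈ U} 2^a` of a vertex set (injective in `U`; every nonempty set has weight `≥ 1`). -/
def wt (U : Finset (Fin h)) : ℕ := ∑ a ∈ U, 2 ^ (a : ℕ)

/-- The `x`-weight `Λ(m) = Σ_a m(x_a)·2^a` of a monomial of `Fin (h + h)`. -/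
def xwt (m : Fin (h + h) →₀ ℕ) : ℕ := ∑ a : Fin h, m (Fin.castAdd h a) * 2 ^ (a : ℕ)

/-- The `y`-weight `Μ(m) = Σ_c m(y_c)·2^c` of a monomial of `Fin (h + h)`. -/
def ywt (m : Fin (h + h) →₀ ℕ) : ℕ := ∑ c : Fin h, m (Fin.natAdd h c) * 2 ^ (c : ℕ)

/-- `λ` is injective (binary representation). -/
theorem wt_injective : Function.Injective (wt (h := h)) := by
  intro U V hUV
  have h1 : ∀ U : Finset (Fin h), wt U = ∑ i ∈ U.map Fin.valEmbedding, 2 ^ i := fun U => by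
    rw [wt, Finset.sum_map]; rfl
  rw [h1, h1, ← Finset.equivBitIndices_symm_apply, ← Finset.equivBitIndices_symm_apply] at hUV
  exact Finset.map_injective Fin.valEmbedding (Finset.equivBitIndices.symm.injective hUV)

/-- `λ(U) = 0 ↔ U = ∅`. -/
theorem wt_eq_zero_iff (U : Finset (Fin h)) : wt U = 0 ↔ U = ∅ := by
  rw [wt, Finset.sum_eq_zero_iff]
  constructor
  · intro hz
    exact Finset.eq_empty_of_forall_notMem (fun a ha => absurd (hz a ha) (by positivity))
  · rintro rfl a ha
    exact absurd ha (Finset.notMem_empty a)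

/-- `λ(insert c D) = 2^c + λ(D)` for `c ∉ D`. -/
theorem wt_insert {c : Fin h} {D : Finset (Fin h)} (hc : c ∉ D) : wt (insert c D) = 2 ^ (c : ℕ) + wt D := by
  rw [wt, wt, Finset.sum_insert hc]

/-- `λ({c}) = 2^c`. -/
theorem wt_singleton (c : Fin h) : wt ({c} : Finset (Fin h)) = 2 ^ (c : ℕ) := by
  rw [wt, Finset.sum_singleton]

/-- `Λ` is additive. -/
theorem xwt_add (m₁ m₂ : Fin (h + h) →₀ ℕ) : xwt (m₁ + m₂) = xwt m₁ + xwt m₂ := by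
  simp only [xwt, Finsupp.add_apply, add_mul, Finset.sum_add_distrib]

/-- `Μ` is additive. -/
theorem ywt_add (m₁ m₂ : Fin (h + h) →₀ ℕ) : ywt (m₁ + m₂) = ywt m₁ + ywt m₂ := by
  simp only [ywt, Finsupp.add_apply, add_mul, Finset.sum_add_distrib]

/-- `Λ(x^U y^W) = λ(U)`. -/
theorem xwt_pexpo (U W : Finset (Fin h)) : xwt (pexpo U W) = wt U := by
  classical
  unfold xwt wt
  simp only [pexpo_apply_castAdd, ite_mul, one_mul, zero_mul]
  rw [Finset.sum_ite_mem, Finset.univ_inter]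

/-- `Μ(x^U y^W) = λ(W)`. -/
theorem ywt_pexpo (U W : Finset (Fin h)) : ywt (pexpo U W) = wt W := by
  classical
  unfold ywt wt
  simp only [pexpo_apply_natAdd, ite_mul, one_mul, zero_mul]
  rw [Finset.sum_ite_mem, Finset.univ_inter]

/-- `Μ(y_d) = 2^d`. -/
theorem ywt_single_natAdd (d : Fin h) : ywt (Finsupp.single (Fin.natAdd h d) 1) = 2 ^ (d : ℕ) := by
  have : (Finsupp.single (Fin.natAdd h d) 1 : Fin (h + h) →₀ ℕ) = pexpo ∅ {d} := by
    rw [pexpo_def, Finset.sum_empty, Finset.sum_singleton, zero_add]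
  rw [this, ywt_pexpo, wt_singleton]

/-- The product bound `q(m) = Λ(m)·Μ(m)` is superadditive. -/
theorem xwt_mul_ywt_superadd (m₁ m₂ : Fin (h + h) →₀ ℕ) :
    xwt m₁ * ywt m₁ + xwt m₂ * ywt m₂ ≤ xwt (m₁ + m₂) * ywt (m₁ + m₂) := by
  rw [xwt_add, ywt_add]
  nlinarith [Nat.zero_le (xwt m₁ * ywt m₂), Nat.zero_le (xwt m₂ * ywt m₁)]

/-! ## 3. The sparse anchored product and the tropical specialisation -/

/-- The SPARSE anchored product over a coefficient semiring `R`: anchors in `K` only, NO `x`-twists, anchor coefficients `t`,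
`y`-twist coefficients `tψ` (the shape of every specialisation used below). -/
def sparseW (R : Type*) [CommSemiring R] (K : Finset (Finset (Fin h) × Finset (Fin h)))
    (t : Finset (Fin h) × Finset (Fin h) → R) (tψ : Finset (Fin h) × Finset (Fin h) → Fin h → R) :
    MvPolynomial (Fin (h + h)) R :=
  ∏ α ∈ K, (1 + C (t α) * (∏ a ∈ α.1, X (Fin.castAdd h a)) * (∏ c ∈ α.2, X (Fin.natAdd h c)) *
    ∏ d ∈ univ \ α.2, (1 + C (tψ α d) * X (Fin.natAdd h d)))

/-- Ring maps act on the sparse product coefficientwise. -/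
theorem map_sparseW {R S : Type*} [CommSemiring R] [CommSemiring S] (f : R →+* S)
    (K : Finset (Finset (Fin h) × Finset (Fin h))) (t : Finset (Fin h) × Finset (Fin h) → R)
    (tψ : Finset (Fin h) × Finset (Fin h) → Fin h → R) :
    MvPolynomial.map f (sparseW R K t tψ) = sparseW S K (fun α => f (t α)) (fun α d => f (tψ α d)) := by
  unfold sparseW
  rw [map_prod]
  refine Finset.prod_congr rfl (fun α _ => ?_)
  simp only [map_add, map_one, map_mul, map_prod, map_C, map_X]

/-- The TROPICAL SPECIALISATION of the parameters attached to a set of anchors `K`: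
`θ_α ↦ T^{λ(α.1)·λ(α.2)}` for `α ∈ K`, `θ_α ↦ 0` for `α ∉ K`, every `x`-twist `φ ↦ 0`, `ψ_{α d} ↦ T^{λ(α.1)·2^d}`. -/
def tropSpec (K : Finset (Finset (Fin h) × Finset (Fin h))) : Param h → Polynomial ℂ
  | Sum.inl α => if α ∈ K then Polynomial.X ^ (wt α.1 * wt α.2) else 0
  | Sum.inr (Sum.inl _) => 0
  | Sum.inr (Sum.inr (α, d)) => Polynomial.X ^ (wt α.1 * 2 ^ (d : ℕ))

/-- The `ℕ[T]`-form of the specialised witness (natural coefficients: lower bounds come for free). -/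
def tropW (K : Finset (Finset (Fin h) × Finset (Fin h))) : MvPolynomial (Fin (h + h)) (Polynomial ℕ) :=
  sparseW (Polynomial ℕ) K (fun α => Polynomial.X ^ (wt α.1 * wt α.2))
    (fun α d => Polynomial.X ^ (wt α.1 * 2 ^ (d : ℕ)))

/-- Under the specialisation an anchor factor outside `K` dies (becomes `1`). -/
theorem map_tropSpec_symbFactor_of_notMem (K : Finset (Finset (Fin h) × Finset (Fin h)))
    {α : Finset (Fin h) × Finset (Fin h)} (hα : α ∉ K) :
    MvPolynomial.map (aeval (tropSpec K)).toRingHom (symbFactor h α) = 1 := by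
  rw [symbFactor]
  simp only [map_add, map_one, map_mul, map_C, AlgHom.toRingHom_eq_coe, RingHom.coe_coe, aeval_X, tropSpec,
    if_neg hα, map_zero, zero_mul, add_zero]

/-- Under the specialisation an anchor factor inside `K` becomes the sparse factor (its `x`-twists die). -/
theorem map_tropSpec_symbFactor_of_mem (K : Finset (Finset (Fin h) × Finset (Fin h)))
    {α : Finset (Fin h) × Finset (Fin h)} (hα : α ∈ K) :
    MvPolynomial.map (aeval (tropSpec K)).toRingHom (symbFactor h α) =
      1 + C (Polynomial.X ^ (wt α.1 * wt α.2)) * (∏ a ∈ α.1, X (Fin.castAdd h a)) * (∏ c ∈ α.2, X (Fin.natAdd h c)) *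
        ∏ d ∈ univ \ α.2, (1 + C (Polynomial.X ^ (wt α.1 * 2 ^ (d : ℕ))) * X (Fin.natAdd h d)) := by
  rw [symbFactor]
  simp only [map_add, map_one, map_mul, map_prod, map_C, map_X, AlgHom.toRingHom_eq_coe, RingHom.coe_coe, aeval_X,
    tropSpec, if_pos hα, map_zero, zero_mul, add_zero, Finset.prod_const_one, mul_one]

/-- **The specialised symbolic witness is the sparse product over `ℂ[T]`** (for `K ⊆ anchors s h`). -/
theorem map_tropSpec_symbolicWitness (s h : ℕ) (K : Finset (Finset (Fin h) × Finset (Fin h)))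
    (hK : K ⊆ anchors s h) :
    MvPolynomial.map (aeval (tropSpec K)).toRingHom (symbolicWitness s h) =
      sparseW (Polynomial ℂ) K (fun α => Polynomial.X ^ (wt α.1 * wt α.2))
        (fun α d => Polynomial.X ^ (wt α.1 * 2 ^ (d : ℕ))) := by
  rw [symbolicWitness_eq_prod, map_prod, sparseW,
    ← Finset.prod_subset hK (fun α _ hαK => map_tropSpec_symbFactor_of_notMem K hαK)]
  exact Finset.prod_congr rfl (fun α hα => map_tropSpec_symbFactor_of_mem K hα)

/-- … and it is the image of the `ℕ[T]`-form under `ℕ[T] → ℂ[T]`. -/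
theorem map_natCast_tropW (K : Finset (Finset (Fin h) × Finset (Fin h))) :
    MvPolynomial.map (Polynomial.mapRingHom (Nat.castRingHom ℂ)) (tropW K) =
      sparseW (Polynomial ℂ) K (fun α => Polynomial.X ^ (wt α.1 * wt α.2))
        (fun α d => Polynomial.X ^ (wt α.1 * 2 ^ (d : ℕ))) := by
  rw [tropW, map_sparseW]
  simp only [Polynomial.coe_mapRingHom, Polynomial.map_pow, Polynomial.map_X]

/-! ## 4. Degree bounds for the `ℕ[T]`-form -/

/-- A product of distinct variables times a constant is a monomial. -/
theorem C_mul_prod_X_mul_prod_X {R : Type*} [CommSemiring R] (p : R) (A B : Finset (Fin h)) :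
    (C p * (∏ a ∈ A, X (Fin.castAdd h a)) * (∏ c ∈ B, X (Fin.natAdd h c)) : MvPolynomial (Fin (h + h)) R) =
      monomial (pexpo A B) p := by
  rw [mul_assoc, prod_X_eq_monomial', prod_X_eq_monomial', monomial_mul, mul_one, C_mul_monomial, mul_one,
    ← pexpo_def]

/-- The `y`-twist product of an anchor with `x`-part `A` obeys the linear bound `λ(A)·Μ(m)`. -/
theorem degLE_tail (A B : Finset (Fin h)) :
    ∀ m, (coeff m (∏ d ∈ univ \ B, (1 + C (Polynomial.X ^ (wt A * 2 ^ (d : ℕ))) * X (Fin.natAdd h d)) :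
      MvPolynomial (Fin (h + h)) (Polynomial ℕ))).natDegree ≤ wt A * ywt m := by
  refine degLE_prod (q := fun m => wt A * ywt m) (fun m₁ m₂ => le_of_eq (by rw [ywt_add, mul_add])) _ _
    (fun d _ => ?_)
  refine degLE_add (degLE_one _) ?_
  rw [C_mul_X_eq_monomial]
  refine degLE_monomial _ _ (le_of_eq ?_)
  rw [Polynomial.natDegree_X_pow, ywt_single_natAdd]

/-- The anchor part `θ x^A y^B · (y-twists)` of a sparse factor obeys the product bound `Λ(m)·Μ(m)`. -/
theorem degLE_anchorPart (A B : Finset (Fin h)) :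
    ∀ m, (coeff m ((C (Polynomial.X ^ (wt A * wt B)) * (∏ a ∈ A, X (Fin.castAdd h a)) *
      (∏ c ∈ B, X (Fin.natAdd h c)) *
      ∏ d ∈ univ \ B, (1 + C (Polynomial.X ^ (wt A * 2 ^ (d : ℕ))) * X (Fin.natAdd h d))) :
        MvPolynomial (Fin (h + h)) (Polynomial ℕ))).natDegree ≤ xwt m * ywt m := by
  rw [C_mul_prod_X_mul_prod_X]
  refine degLE_mul_of_support (F := fun m => xwt m * ywt m) (G := fun m => wt A * ywt m)
    (degLE_monomial _ _ (le_of_eq ?_)) (degLE_tail A B) (fun m₁ hm₁ m₂ _ => ?_)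
  · rw [Polynomial.natDegree_X_pow, xwt_pexpo, ywt_pexpo]
  · have hm₁' : m₁ = pexpo A B := Finset.mem_singleton.mp (support_monomial_subset hm₁)
    rw [hm₁', xwt_add, ywt_add, xwt_pexpo]
    nlinarith [Nat.zero_le (xwt m₂ * (ywt (pexpo A B) + ywt m₂))]

/-- **UPPER BOUND (monomial form):** `natDegree ([m] tropW K) ≤ Λ(m)·Μ(m)` for every monomial `m`. -/
theorem natDegree_coeff_tropW_le (K : Finset (Finset (Fin h) × Finset (Fin h))) :
    ∀ m, (coeff m (tropW K)).natDegree ≤ xwt m * ywt m := by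
  unfold tropW sparseW
  exact degLE_prod xwt_mul_ywt_superadd _ _ (fun α _ => degLE_add (degLE_one _) (degLE_anchorPart α.1 α.2))

/-- **UPPER BOUND (layout form):** the entry `[x^U y^W] tropW K` has `T`-degree `≤ λ(U)·λ(W)`. -/
theorem natDegree_coeff_pexpo_tropW_le (K : Finset (Finset (Fin h) × Finset (Fin h))) (U W : Finset (Fin h)) :
    (coeff (pexpo U W) (tropW K)).natDegree ≤ wt U * wt W := by
  have := natDegree_coeff_tropW_le K (pexpo U W)
  rwa [xwt_pexpo, ywt_pexpo] at this

/-! ## 5. Lower bounds for the `ℕ[T]`-form -/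

/-- `∏_{d ∈ P} (1 + C (t d)·X_{e d}) = Σ_{D ⊆ P} monomial (Σ_{d ∈ D} e_d) (∏_{d ∈ D} t d)`. -/
theorem prod_one_add_C_mul_X_fun {R : Type*} [CommSemiring R] (t : Fin h → R) (P : Finset (Fin h))
    (e : Fin h → Fin (h + h)) :
    (∏ d ∈ P, (1 + C (t d) * X (e d)) : MvPolynomial (Fin (h + h)) R) =
      ∑ D ∈ P.powerset, monomial (∑ d ∈ D, Finsupp.single (e d) 1) (∏ d ∈ D, t d) := by
  rw [Finset.prod_one_add]
  refine Finset.sum_congr rfl (fun D _ => ?_)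
  rw [Finset.prod_mul_distrib, ← map_prod C, prod_X_eq_monomial', C_mul_monomial, mul_one]

/-- `pexpo ∅ ∅ = 0`. -/
theorem pexpo_empty_empty : pexpo (∅ : Finset (Fin h)) ∅ = 0 := by
  rw [pexpo_def, Finset.sum_empty, Finset.sum_empty, add_zero]

/-- In `ℕ[T]`: the coefficient of `T^{λ(A)·λ(D)}` in `[y^D] (y-twists of an anchor (A | B))` is `≥ 1` whenever `D` avoids `B`. -/
theorem one_le_coeff_tail (A B D : Finset (Fin h)) (hD : Disjoint D B) :
    1 ≤ (coeff (pexpo ∅ D) (∏ d ∈ univ \ B, (1 + C (Polynomial.X ^ (wt A * 2 ^ (d : ℕ))) * X (Fin.natAdd h d)) :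
      MvPolynomial (Fin (h + h)) (Polynomial ℕ))).coeff (wt A * wt D) := by
  classical
  rw [prod_one_add_C_mul_X_fun, coeff_sum, Polynomial.finsetSum_coeff]
  have hDmem : D ∈ (univ \ B).powerset := Finset.mem_powerset.mpr (fun d hd =>
    Finset.mem_sdiff.mpr ⟨Finset.mem_univ _, fun hdB => (Finset.disjoint_left.mp hD) hd hdB⟩)
  refine le_trans (le_of_eq ?_) (Finset.single_le_sum (fun D' _ => Nat.zero_le _) hDmem)
  have hpe : (∑ d ∈ D, Finsupp.single (Fin.natAdd h d) 1 : Fin (h + h) →₀ ℕ) = pexpo ∅ D := by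
    rw [pexpo_def, Finset.sum_empty, zero_add]
  rw [hpe, coeff_monomial, if_pos rfl, Finset.prod_pow_eq_pow_sum, ← Finset.mul_sum, show ∑ d ∈ D, 2 ^ (d : ℕ) = wt D from rfl,
    Polynomial.coeff_X_pow_self]

/-- **LOWER BOUND at a matched entry.** If `(U | {c}) ∈ K` and `c ∈ W`, the coefficient of `T^{λ(U)·λ(W)}` in `[x^U y^W] tropW K`
is `≥ 1` (the term: anchor `(U | {c})`, `y`-tails `W ∖ {c}`, all other factors `1`). -/
theorem one_le_coeff_tropW_anchor (K : Finset (Finset (Fin h) × Finset (Fin h))) (U W : Finset (Fin h)) (c : Fin h)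
    (hK : (U, ({c} : Finset (Fin h))) ∈ K) (hc : c ∈ W) :
    1 ≤ (coeff (pexpo U W) (tropW K)).coeff (wt U * wt W) := by
  classical
  unfold tropW sparseW
  rw [Finset.prod_one_add, coeff_sum, Polynomial.finsetSum_coeff]
  have hJ : ({(U, ({c} : Finset (Fin h)))} : Finset (Finset (Fin h) × Finset (Fin h))) ∈ K.powerset :=
    Finset.mem_powerset.mpr (Finset.singleton_subset_iff.mpr hK)
  refine le_trans ?_ (Finset.single_le_sum (fun J _ => Nat.zero_le _) hJ)
  rw [Finset.prod_singleton, C_mul_prod_X_mul_prod_X, coeff_monomial_mul',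
    if_pos ((pexpo_le_iff _ _ _ _).mpr ⟨subset_rfl, Finset.singleton_subset_iff.mpr hc⟩)]
  have hsplit : pexpo U ({c} : Finset (Fin h)) + pexpo ∅ (W.erase c) = pexpo U W := by
    rw [← pexpo_union (Finset.disjoint_empty_right U)
      (Finset.disjoint_singleton_left.mpr (Finset.notMem_erase c W)), Finset.union_empty, ← Finset.insert_eq,
      Finset.insert_erase hc]
  have hsub : pexpo U W - pexpo U ({c} : Finset (Fin h)) = pexpo ∅ (W.erase c) := by
    rw [← hsplit, add_tsub_cancel_left]
  have hW : wt W = 2 ^ (c : ℕ) + wt (W.erase c) := by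
    rw [← wt_insert (Finset.notMem_erase c W), Finset.insert_erase hc]
  rw [hsub]
  dsimp only
  rw [wt_singleton, hW, mul_add, add_comm (wt U * 2 ^ (c : ℕ)) (wt U * wt (W.erase c)), Polynomial.coeff_X_pow_mul]
  exact one_le_coeff_tail U {c} (W.erase c) (Finset.disjoint_singleton_right.mpr (Finset.notMem_erase c W))

/-- **LOWER BOUND at the empty entry:** `[1] tropW K` has constant `T`-coefficient `≥ 1`. -/
theorem one_le_coeff_tropW_zero (K : Finset (Finset (Fin h) × Finset (Fin h))) :
    1 ≤ (coeff 0 (tropW K)).coeff 0 := by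
  classical
  unfold tropW sparseW
  rw [Finset.prod_one_add, coeff_sum, Polynomial.finsetSum_coeff]
  refine le_trans (le_of_eq ?_) (Finset.single_le_sum (fun J _ => Nat.zero_le _) (Finset.empty_mem_powerset K))
  rw [Finset.prod_empty, MvPolynomial.coeff_one, if_pos rfl, Polynomial.coeff_one_zero]

end ProductRule

end

end Summit.ValiantsHypothesis.ValiantsHypothesis.Theorems.BarrierLever.AnchoredPeeling
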